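import Summits.NavierStokesRegularity.NavierStokesRegularity.Theorems.WakeRatchetEternalInviscidRateBlockDSSWakeFloor

/-!
# Conveyor ledger (crux `WakeRatchet.EternalInviscidRate`, ⟨stmt-NavierStokesRegularity-25646⟩) —
# per-shell `stub_wakeFloor` on block-self-similar fronts demands INTRA-BLOCK EVENNESS of the final wakes

Helpers for the open heart stub `stub_wakeFloor` (`∃ κ < 1/2, WakeFloor R κ`) of the registered skeleton «conveyor ledger» (LINE g10-3, sha16
d183ebc25b56, namespace `…Cruxes.EternalInviscidRate.FinalWakeLedger`) and for the planners' BLOCK re-typing (LINE g11-2, `wakeFloorBlock`).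
MODEL lattice only (Tao 2016 §4 renormalised cascade); nothing here is a statement about the Navier–Stokes equations, no stub is closed by name,
no summit is proved by this file.

The landed `…BlockDSSWakeFloor` read the stub on period-ONE fronts (`WakeFloor(q)` ≡ `dssMu ≤ q`).  Here: fronts of ANY shell period `p ≥ 1`,
`W_{n+p}(σ) = W_n(σ − T)` (pulsating / period-doubled blow-up, the generic bifurcated regime of inviscid shell models), block ratio
`ϱ = e^{2T}Λ^{-2p}` (final wakes scale by `ϱ` along the block shift, landed `finalWake_blockShift`).  Pure bookkeeping on the wake sequence:
* `wakeSum_eq_blockWake_div` — `Σ_{k≥0} ω(n+k) = (Σ_{j<p} ω(n+j)) / (1 − ϱ)` for `ϱ < 1`.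
* `wake_evenness_of_wakeFloor` — the inner inequality of `WakeFloor` with factor `q < 1` at shell `n` (all truncations `K`),
  `Σ_{k<K} ω(n+1+k) ≤ q·Σ_{k<K+1} ω(n+k)`, forces `(1 − q)·Σ_{j<p} ω(n+j) ≤ (1 − ϱ)·ω(n)`: EVERY shell must strand at least the fraction
  `(1−q)/(1−ϱ)` of its whole block's wake.
* `wake_succ_le_of_wakeFloor` — hence (any `p ≥ 2`) `(1 − q)·ω(n+1) ≤ (q − ϱ)·ω(n)`: consecutive final wakes may grow by at most the factor
  `(q − ϱ)/(1 − q)`, and `q ≤ ϱ` forces `ω(n+1) = 0`.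
* `wake_window_of_wakeFloor_two` — period `2`, floor at shells `n` and `n+1`: `(1−q)ϱ·ω(n) ≤ (q−ϱ)·ω(n+1)` AND `(1−q)·ω(n+1) ≤ (q−ϱ)·ω(n)` —
  the wake ratio `ω(n+1)/ω(n)` is confined to the window `[(1−q)ϱ/(q−ϱ), (q−ϱ)/(1−q)]`.
* `blockDSS_wake_evenness` / `blockDSS_wake_succ_le` — the same for the final wakes of a block-self-similar shell field `W` (wakes supplied by
  the landed `stub_wakeLimit`, summability by `UniformBound` + `stub_tailLimit`).
Reading (`q = (1+ε₀)^{κ−5/3}`, `ϱ = (1+ε₀)^{−ap}` for a block retention exponent `a`): `(q−ϱ)/(1−q) → (ap − 5/3 + κ)/(5/3 − κ)` as `ε₀ → 0`;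
at the Kolmogorov block rate `a = 5/3`, `p = 2`, `κ ↑ 1/2` the window is `[7/13, 13/7]`: a period-doubled front at EXACT K41 block rate whose two
wakes differ by more than the factor `13/7` violates `stub_wakeFloor` for every `κ < 1/2`.  The per-shell floor is a statement about the
EVENNESS of pulsating fronts, not only about their retention — the block form `wakeFloorBlock` (LINE g11-2) is the repair; cf. instrument E-g10-2/3
(per-shell envelope rates `< 1` at a positive fraction of shells while block rates stay `> 1`).
[cite: Tao2016AveragedNS, §4 Lemma 4.1 (4.8)–(4.10), in the self-similar variables of §6.4; doi:10.1088/0951-7715/26/4/1105 (period-doubled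
blow-up in inviscid shell models)]
-/

noncomputable section

set_option linter.dupNamespace false

open Filter Topology
open Literature.Analysis.FluidPDE Literature.Analysis.FluidPDE.TaoCascade
open Summit.NavierStokesRegularity.NavierStokesRegularity.Theorems

namespace Summit.NavierStokesRegularity.NavierStokesRegularity.Cruxes.EternalInviscidRate.FinalWakeLedger

/-! ## Wake sequences scaled along a block shift (pure bookkeeping) -/

section WakeSequence

variable {ω : ℤ → ℝ} {p : ℕ} {ϱ : ℝ}

/-- Along a block shift the shifted wake sum scales: `Σ_k ω(n+p+k) = ϱ · Σ_k ω(n+k)`. -/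
theorem wakeSum_shift (hper : ∀ k : ℤ, ω (k + p) = ϱ * ω k) (n : ℤ) :
    ∑' k : ℕ, ω (n + p + k) = ϱ * ∑' k : ℕ, ω (n + k) := by
  rw [← tsum_mul_left]
  refine tsum_congr fun k => ?_
  rw [show n + (p : ℤ) + (k : ℤ) = n + k + p by ring]
  exact hper (n + k)

/-- The wake sum splits off one block: `Σ_k ω(n+k) = Σ_{j<p} ω(n+j) + Σ_k ω(n+p+k)`. -/
theorem wakeSum_block (hsum : ∀ n : ℤ, Summable (fun k : ℕ => ω (n + k))) (n : ℤ) :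
    ∑' k : ℕ, ω (n + k) = ∑ j ∈ Finset.range p, ω (n + j) + ∑' k : ℕ, ω (n + p + k) := by
  have h := (hsum n).sum_add_tsum_nat_add p
  have e : (fun k : ℕ => ω (n + ((k + p : ℕ) : ℤ))) = fun k : ℕ => ω (n + p + k) := by
    funext k; push_cast; ring_nf
  rw [e] at h
  exact h.symm

/-- **Wake sum of a block-scaled sequence:** `(1 − ϱ) · Σ_k ω(n+k) = Σ_{j<p} ω(n+j)`. -/
theorem wakeSum_eq_blockWake (hper : ∀ k : ℤ, ω (k + p) = ϱ * ω k)
    (hsum : ∀ n : ℤ, Summable (fun k : ℕ => ω (n + k))) (n : ℤ) :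
    (1 - ϱ) * ∑' k : ℕ, ω (n + k) = ∑ j ∈ Finset.range p, ω (n + j) := by
  have h := wakeSum_block (p := p) hsum n
  rw [wakeSum_shift hper n] at h
  linarith

/-- The same as a quotient, for `ϱ < 1`: `Σ_k ω(n+k) = (Σ_{j<p} ω(n+j)) / (1 − ϱ)`. -/
theorem wakeSum_eq_blockWake_div (hper : ∀ k : ℤ, ω (k + p) = ϱ * ω k)
    (hsum : ∀ n : ℤ, Summable (fun k : ℕ => ω (n + k))) (hϱ : ϱ < 1) (n : ℤ) :
    ∑' k : ℕ, ω (n + k) = (∑ j ∈ Finset.range p, ω (n + j)) / (1 - ϱ) := by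
  rw [eq_div_iff (by linarith : (1 - ϱ) ≠ 0), mul_comm]
  exact wakeSum_eq_blockWake hper hsum n

/-- The truncated wake-floor inequality passes to the limit: `Σ_k ω(n+1+k) ≤ q · Σ_k ω(n+k)`. -/
theorem wakeSum_succ_le_of_wakeFloor
    (hsum : ∀ n : ℤ, Summable (fun k : ℕ => ω (n + k))) {q : ℝ} {n : ℤ}
    (hWF : ∀ K : ℕ, ∑ k ∈ Finset.range K, ω (n + 1 + k) ≤ q * ∑ k ∈ Finset.range (K + 1), ω (n + k)) :
    ∑' k : ℕ, ω (n + 1 + k) ≤ q * ∑' k : ℕ, ω (n + k) := by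
  have h1 : Tendsto (fun K : ℕ => ∑ k ∈ Finset.range K, ω (n + 1 + k)) atTop (𝓝 (∑' k : ℕ, ω (n + 1 + k))) :=
    (hsum (n + 1)).hasSum.tendsto_sum_nat
  have h2 : Tendsto (fun K : ℕ => q * ∑ k ∈ Finset.range (K + 1), ω (n + k)) atTop (𝓝 (q * ∑' k : ℕ, ω (n + k))) :=
    (((hsum n).hasSum.tendsto_sum_nat).comp (tendsto_add_atTop_nat 1)).const_mul q
  exact le_of_tendsto_of_tendsto' h1 h2 hWF

/-- **Per-shell wake floor ⇒ intra-block evenness.**  For a wake sequence scaled by `ϱ < 1` along a block shift of length `p` (summable above every shell),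
the inner inequality of `WakeFloor` with factor `q` at shell `n` (all truncations) forces shell `n` to strand at least the fraction
`(1−q)/(1−ϱ)` of its block's wake: `(1 − q)·Σ_{j<p} ω(n+j) ≤ (1 − ϱ)·ω(n)`. -/
theorem wake_evenness_of_wakeFloor (hper : ∀ k : ℤ, ω (k + p) = ϱ * ω k)
    (hsum : ∀ n : ℤ, Summable (fun k : ℕ => ω (n + k))) (hϱ : ϱ < 1) {q : ℝ} {n : ℤ}
    (hWF : ∀ K : ℕ, ∑ k ∈ Finset.range K, ω (n + 1 + k) ≤ q * ∑ k ∈ Finset.range (K + 1), ω (n + k)) :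
    (1 - q) * ∑ j ∈ Finset.range p, ω (n + j) ≤ (1 - ϱ) * ω n := by
  have hlim := wakeSum_succ_le_of_wakeFloor hsum hWF
  -- `Ω_n = ω n + Ω_{n+1}` and `(1-ϱ) Ω_n = B_n`
  have hsplit : ∑' k : ℕ, ω (n + k) = ω n + ∑' k : ℕ, ω (n + 1 + k) := by
    have h := wakeSum_block (p := 1) hsum n
    simpa using h
  have hB := wakeSum_eq_blockWake hper hsum n
  -- `(1-q) Ω_n ≤ ω n`, multiply by `1 - ϱ > 0`
  have h1 : (1 - q) * ∑' k : ℕ, ω (n + k) ≤ ω n := by nlinarith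
  have h2 := mul_le_mul_of_nonneg_left h1 (by linarith : (0 : ℝ) ≤ 1 - ϱ)
  calc (1 - q) * ∑ j ∈ Finset.range p, ω (n + j) = (1 - ϱ) * ((1 - q) * ∑' k : ℕ, ω (n + k)) := by rw [← hB]; ring
    _ ≤ (1 - ϱ) * ω n := h2

/-- **Consecutive wakes** (block length `p ≥ 2`): the per-shell wake floor with factor `q` at shell `n` forces
`(1 − q)·ω(n+1) ≤ (q − ϱ)·ω(n)` — consecutive final wakes grow by at most the factor `(q−ϱ)/(1−q)`; `q ≤ ϱ` forces `ω(n+1) = 0`. -/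
theorem wake_succ_le_of_wakeFloor (hω0 : ∀ k : ℤ, 0 ≤ ω k) (hper : ∀ k : ℤ, ω (k + p) = ϱ * ω k)
    (hsum : ∀ n : ℤ, Summable (fun k : ℕ => ω (n + k))) (hϱ : ϱ < 1) (hp : 2 ≤ p) {q : ℝ} {n : ℤ}
    (hWF : ∀ K : ℕ, ∑ k ∈ Finset.range K, ω (n + 1 + k) ≤ q * ∑ k ∈ Finset.range (K + 1), ω (n + k)) :
    (1 - q) * ω (n + 1) ≤ (q - ϱ) * ω n := by
  have hev := wake_evenness_of_wakeFloor hper hsum hϱ hWF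
  -- the block contains shells `n` and `n+1`
  have hq1 : 0 ≤ 1 - q ∨ 1 - q < 0 := le_or_gt 0 (1 - q)
  have hB2 : ω n + ω (n + 1) ≤ ∑ j ∈ Finset.range p, ω (n + j) := by
    have hsub : Finset.range 2 ⊆ Finset.range p := Finset.range_subset_range.2 hp
    have h := Finset.sum_le_sum_of_subset_of_nonneg hsub (fun j _ _ => hω0 (n + (j : ℤ)))
    simpa [Finset.sum_range_succ] using h
  rcases hq1 with hq | hq
  · have h := mul_le_mul_of_nonneg_left hB2 hq
    linarith
  · -- `q > 1`: the conclusion is trivial since `(1-q) ω(n+1) ≤ 0 ≤ (q - ϱ) ω n`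
    have h1 : (1 - q) * ω (n + 1) ≤ 0 := mul_nonpos_of_nonpos_of_nonneg hq.le (hω0 _)
    have h2 : 0 ≤ (q - ϱ) * ω n := mul_nonneg (by linarith) (hω0 _)
    linarith

/-- **Period two: the evenness window.**  For a nonnegative wake sequence with `ω(k+2) = ϱ·ω(k)`, `ϱ < 1`, the per-shell wake floor with
factor `q` at BOTH shells `n` and `n+1` confines the wake ratio: `(1−q)·ϱ·ω(n) ≤ (q−ϱ)·ω(n+1)` and `(1−q)·ω(n+1) ≤ (q−ϱ)·ω(n)`, i.e.
`ω(n+1)/ω(n) ∈ [(1−q)ϱ/(q−ϱ), (q−ϱ)/(1−q)]` whenever these quotients make sense. -/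
theorem wake_window_of_wakeFloor_two (hω0 : ∀ k : ℤ, 0 ≤ ω k) (hper : ∀ k : ℤ, ω (k + (2 : ℕ)) = ϱ * ω k)
    (hsum : ∀ n : ℤ, Summable (fun k : ℕ => ω (n + k))) (hϱ : ϱ < 1) {q : ℝ} {n : ℤ}
    (hWF₀ : ∀ K : ℕ, ∑ k ∈ Finset.range K, ω (n + 1 + k) ≤ q * ∑ k ∈ Finset.range (K + 1), ω (n + k))
    (hWF₁ : ∀ K : ℕ, ∑ k ∈ Finset.range K, ω (n + 1 + 1 + k) ≤ q * ∑ k ∈ Finset.range (K + 1), ω (n + 1 + k)) :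
    (1 - q) * ϱ * ω n ≤ (q - ϱ) * ω (n + 1) ∧ (1 - q) * ω (n + 1) ≤ (q - ϱ) * ω n := by
  refine ⟨?_, wake_succ_le_of_wakeFloor hω0 hper hsum hϱ le_rfl hWF₀⟩
  have h := wake_succ_le_of_wakeFloor hω0 hper hsum hϱ le_rfl hWF₁
  have e : ω (n + 1 + 1) = ϱ * ω n := by
    rw [show n + 1 + 1 = n + ((2 : ℕ) : ℤ) by push_cast; ring]
    exact hper n
  rw [e] at h
  linarith

end WakeSequence

/-! ## The final wakes of a block-self-similar shell field -/

variable {m : ℕ} {ε₀ : ℝ} {W : ℤ → ℝ → Em m}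

/-- **Per-shell `WakeFloor` on a block-self-similar front ⇒ intra-block evenness of the final wakes.**  Let `W` be a uniformly bounded shell
field, block-self-similar with shell period `p ≥ 1`, `W_{n+p}(σ) = W_n(σ−T)`, block ratio `ϱ = e^{2T}Λ^{-2p} < 1`, with final wakes `ω` and
final tails `L`.  If the inner inequality of `WakeFloor` with factor `q` holds at shell `n` for every truncation, then
`(1 − q)·Σ_{j<p} ω(n+j) ≤ (1 − ϱ)·ω(n)`.  MODEL lattice only.
[cite: Tao2016AveragedNS, §4 Lemma 4.1 (4.8)–(4.10), in the self-similar variables of §6.4] -/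
theorem blockDSS_wake_evenness (hε : 0 < ε₀) (hU : UniformBound W) {p : ℕ} {T : ℝ}
    (hD : ∀ (n : ℤ) (σ : ℝ), W (n + p) σ = W n (σ - T))
    (hϱ : Real.exp (2 * T) * (bigLam ε₀ ^ p)⁻¹ ^ 2 < 1)
    {ω : ℤ → ℝ} (hω : ∀ k : ℤ, Tendsto (physEnergy ε₀ W k) atTop (𝓝 (ω k)))
    {L : ℤ → ℝ} (hL : ∀ n : ℤ, Tendsto (fun σ => ∑' k : ℕ, physEnergy ε₀ W (n + k) σ) atTop (𝓝 (L n)))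
    {q : ℝ} {n : ℤ}
    (hWF : ∀ K : ℕ, ∑ k ∈ Finset.range K, ω (n + 1 + k) ≤ q * ∑ k ∈ Finset.range (K + 1), ω (n + k)) :
    (1 - q) * ∑ j ∈ Finset.range p, ω (n + j) ≤ (1 - Real.exp (2 * T) * (bigLam ε₀ ^ p)⁻¹ ^ 2) * ω n := by
  have hS : ∀ (n : ℤ) (σ : ℝ), Summable (fun k : ℕ => physEnergy ε₀ W (n + k) σ) :=
    summable_physEnergy_tail_cm hε hU
  exact wake_evenness_of_wakeFloor
    (fun k => finalWake_blockShift hε hD hω k) (fun n => finalWake_summable hS hω hL n) hϱ hWF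

/-- **Consecutive final wakes of a block-self-similar front under the per-shell floor** (`p ≥ 2`):
`(1 − q)·ω(n+1) ≤ (q − ϱ)·ω(n)`.  MODEL lattice only.
[cite: Tao2016AveragedNS, §4 Lemma 4.1 (4.8)–(4.10), in the self-similar variables of §6.4] -/
theorem blockDSS_wake_succ_le (hε : 0 < ε₀) (hU : UniformBound W) {p : ℕ} (hp : 2 ≤ p) {T : ℝ}
    (hD : ∀ (n : ℤ) (σ : ℝ), W (n + p) σ = W n (σ - T))
    (hϱ : Real.exp (2 * T) * (bigLam ε₀ ^ p)⁻¹ ^ 2 < 1)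
    {ω : ℤ → ℝ} (hω : ∀ k : ℤ, Tendsto (physEnergy ε₀ W k) atTop (𝓝 (ω k)))
    {L : ℤ → ℝ} (hL : ∀ n : ℤ, Tendsto (fun σ => ∑' k : ℕ, physEnergy ε₀ W (n + k) σ) atTop (𝓝 (L n)))
    {q : ℝ} {n : ℤ}
    (hWF : ∀ K : ℕ, ∑ k ∈ Finset.range K, ω (n + 1 + k) ≤ q * ∑ k ∈ Finset.range (K + 1), ω (n + k)) :
    (1 - q) * ω (n + 1) ≤ (q - Real.exp (2 * T) * (bigLam ε₀ ^ p)⁻¹ ^ 2) * ω n := by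
  have hS : ∀ (n : ℤ) (σ : ℝ), Summable (fun k : ℕ => physEnergy ε₀ W (n + k) σ) :=
    summable_physEnergy_tail_cm hε hU
  exact wake_succ_le_of_wakeFloor (fun k => finalWake_nonneg hω k)
    (fun k => finalWake_blockShift hε hD hω k) (fun n => finalWake_summable hS hω hL n) hϱ hp hWF

/-- **Period-2 fronts: the evenness window for the final wakes.**  On a uniformly bounded block-self-similar front of shell period `2`
with block ratio `ϱ < 1`, the per-shell `WakeFloor` inner inequality with factor `q` at shells `n` and `n+1` confines consecutive final wakes to
`(1−q)ϱ·ω(n) ≤ (q−ϱ)·ω(n+1)` and `(1−q)·ω(n+1) ≤ (q−ϱ)·ω(n)`.  MODEL lattice only.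
[cite: Tao2016AveragedNS, §4 Lemma 4.1 (4.8)–(4.10), in the self-similar variables of §6.4] -/
theorem blockDSS_two_wake_window (hε : 0 < ε₀) (hU : UniformBound W) {T : ℝ}
    (hD : ∀ (n : ℤ) (σ : ℝ), W (n + (2 : ℕ)) σ = W n (σ - T))
    (hϱ : Real.exp (2 * T) * (bigLam ε₀ ^ (2 : ℕ))⁻¹ ^ 2 < 1)
    {ω : ℤ → ℝ} (hω : ∀ k : ℤ, Tendsto (physEnergy ε₀ W k) atTop (𝓝 (ω k)))
    {L : ℤ → ℝ} (hL : ∀ n : ℤ, Tendsto (fun σ => ∑' k : ℕ, physEnergy ε₀ W (n + k) σ) atTop (𝓝 (L n)))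
    {q : ℝ} {n : ℤ}
    (hWF₀ : ∀ K : ℕ, ∑ k ∈ Finset.range K, ω (n + 1 + k) ≤ q * ∑ k ∈ Finset.range (K + 1), ω (n + k))
    (hWF₁ : ∀ K : ℕ, ∑ k ∈ Finset.range K, ω (n + 1 + 1 + k) ≤ q * ∑ k ∈ Finset.range (K + 1), ω (n + 1 + k)) :
    (1 - q) * (Real.exp (2 * T) * (bigLam ε₀ ^ (2 : ℕ))⁻¹ ^ 2) * ω n ≤
        (q - Real.exp (2 * T) * (bigLam ε₀ ^ (2 : ℕ))⁻¹ ^ 2) * ω (n + 1) ∧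
      (1 - q) * ω (n + 1) ≤ (q - Real.exp (2 * T) * (bigLam ε₀ ^ (2 : ℕ))⁻¹ ^ 2) * ω n := by
  have hS : ∀ (n : ℤ) (σ : ℝ), Summable (fun k : ℕ => physEnergy ε₀ W (n + k) σ) :=
    summable_physEnergy_tail_cm hε hU
  exact wake_window_of_wakeFloor_two (fun k => finalWake_nonneg hω k)
    (fun k => finalWake_blockShift hε hD hω k) (fun n => finalWake_summable hS hω hL n) hϱ hWF₀ hWF₁

end Summit.NavierStokesRegularity.NavierStokesRegularity.Cruxes.EternalInviscidRate.FinalWakeLedger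

end
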